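import Mathlib
import Summits.QuantumFields.BalabanUV.Beta.CovariantPlateauBlocksEnd
import Summits.QuantumFields.BalabanUV.Beta.MonotoneLoopHolonomy
import Summits.QuantumFields.BalabanUV.Beta.CoarseCoerciveTransportPair

/-!
# Beta / CovariantPlateauBlocksPair — THE GENERAL-U MODEL INSTANCE OF E-I3, PART 4: TWO TRANSPORTS (row-D4 owner's RULING
# R-an4-40-1 (c)∕(d) on d4-p3's FINDING F-d4p3-16).  The covariant block AVERAGE may run through ANY monotone contour family
# `ω` from the block corner (the recursive chains of [B9] (3.55) through nested sub-block corners being the instance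
# `nestedList`), while the quasi-reconstruction (in-block product plateaus) keeps the one-step TREE transports of part 1; the
# mixed loop «tree contour vs ω-contour» is a monotone loop, so by this unit's area law (`MonotoneLoopHolonomy` p223523) its
# defect is `ε ≤ (ν(n−1) choose 2)·α`; d4-p3's `coarse_coercive_cov₂` (p222847) BY NAME then gives
#   **((1 − ε)·((n−2w)/n)^ν)² / (μ₀n^ν + νn^ν(1/w + ν(n−1)α)²) · ‖B‖² ≤ Re B*(Q̃_ω A_W⁻¹ Q̃_ωᵀ)B**
# from the ONE per-plaquette input «in-block plaquettes within α of 1» — j-uniform exactly when `n²α = O(α₀)`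
# (unit `b2b-balaban-beta-d4-p2`, GEN 6, MODEL crew; claim «E-I3-COV-PAIR» journal l.16069; v1.0.1 = docstring-only precision of `crn`
# after d4-p3-g7's XREAD l.16440 INFO-1: the `x_l` of (3.55) are nested base points = `crn L l` exactly; no declaration changed)

HONEST FRAMING: discharging `BetaPertH` makes Bałaban's UV stability UNCONDITIONAL — NOT the continuum limit, NOT the
Clay problem.  HONEST DEPENDENCY (verbatim): «continuum YM on T⁴ ⇐ BetaPertH ∧ nine spine estimates (0/9 proved);
BetaPertH ⇐ (D1) ∧ (D4) ∧ CAP+tail; G-an2-4 gates asym, D1 and NE2/3/4.»  THIS MODULE DISCHARGES NOTHING of `BetaPertH`,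
asserts NOTHING printed and cites nothing as a fact (ABSOLUTE RULE): [folklore] about a MODEL (cubic blocks, any gluing,
orthogonal transporters as DATA, one fine field `W` along fine contours — Bałaban's `Γ^{(j)}` runs through the AVERAGED
fields `Ū^l`, which is NOT modelled; nothing of his operators instantiated).  SHAPES located at [B9] =
`Balaban1985BackgroundPropagators` (3.19) p. 393, (3.35) p. 396, (3.55) p. 401 («the sequence of points y = x_j, x_{j−1}, …,
x₁, x = x₀ is defined by the conditions x_l ∈ B(x_{l+1})» — read as image by d4-p3-g6 and the owner, journal l.15742∕l.15847).
No class change on row D4 or G-B9-15 (width 0; D4 DISCHARGE NO DATE); NOT BetaPertH, NOT continuum, NOT Clay, NOT summit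
progress.

CONTENT (kernel, 0 sorry).  §1 positive lists: `treeList` (the tree contour as a positive word: `posWord (treeList z) =
treeWord z` for `z ≥ 0`), `disp (posWord u) κ = count κ u`, equal displacements ⟹ permutations.  §2 the ω-transports
`Rgen ω x := W(posWord (ω v))` from the corner, for ANY contour family with `disp = emb v`.  §3 **`norm_mixed_loop_le`**:
`‖cpx(Rtr x·(Rgen ω x)ᵀ) − 1‖ ≤ (ν(n−1) choose 2)·α` from the in-block plaquettes (area law p223523 + locality), and d4-p3's
`hdef` form `mixed_defect_le`.  §4 END **`coarse_coercive_plateau_blocks_pair`** (d4-p3's `coarse_coercive_cov₂` BY NAME: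
average on `Rgen ω`, bumps on `Rtr`, this unit's counting from part 2).  §5 the (3.55)-shape instance: nested corners
`crn L l v = L^l⌊v∕L^l⌋`, the recursive positive word `nestedList L m v` (stairs `0 → crn L m v → ⋯ → crn L 0 v = v`),
`disp_posWord_nestedList`, END **`coarse_coercive_plateau_blocks_nested`**.  §6 non-vacuity.
-/

namespace Summit.QuantumFields.BalabanUV.Beta.CovariantPlateauBlocksPair

open scoped BigOperators Matrix Matrix.Norms.L2Operator
open Finset
open Literature.MathematicalPhysics.QuantumFieldTheory.Balaban1983to89.B5Prop11Lower (nsq nsq_nonneg)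
open Literature.MathematicalPhysics.QuantumFieldTheory.Balaban1983to89.B7Prop1Explicit
open Literature.MathematicalPhysics.QuantumFieldTheory.Balaban1983to89.B7Prop1Local (InBox PlaqIn)
open Summit.QuantumFields.BalabanUV.Beta.AccretiveCombesThomasSandwich (sandwich)
open Summit.QuantumFields.BalabanUV.Beta.CoarseCoerciveTransport (covFamily)
open Summit.QuantumFields.BalabanUV.Beta.CoarseCoerciveCovariantEnergy (covDiff)
open Summit.QuantumFields.BalabanUV.Beta.CoarseCoerciveTransportPair (coarse_coercive_cov₂)
open Summit.QuantumFields.BalabanUV.Beta.CoarseCoerciveBlock1D (gramForm gramForm_isHermitian isUnit_gramForm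
  re_form_gramForm re_form_gramForm_nonneg)
open Summit.QuantumFields.BalabanUV.Beta.ThinLoopHolonomy
open Summit.QuantumFields.BalabanUV.Beta.MonotoneLoopHolonomy
open Summit.QuantumFields.BalabanUV.Beta.CovariantPlateauBlocks
open Summit.QuantumFields.BalabanUV.Beta.CovariantPlateauBlocksEnd

noncomputable section

variable {Y : Type*} [Fintype Y] [DecidableEq Y] {Cp : Type*} [Fintype Cp] [DecidableEq Cp] {ν n w : ℕ}

/-! ## §1 Positive lists: the tree contour as a positive word; displacements and permutations -/

/-- The tree contour `Γ_{0,z}` (`z ≥ 0`) as a positive list of directions (axis `ν−1` first, axis `0` last). [folklore] -/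
def treeList (z : Site ν) : List (Fin ν) := (List.finRange ν).reverse.flatMap fun κ => List.replicate (z κ).toNat κ

omit [Fintype Y] [DecidableEq Y] in
/-- For `z ≥ 0` the positive word of `treeList z` IS b07's `treeWord z`. [folklore] -/
theorem posWord_treeList (z : Site ν) (hz : ∀ i, 0 ≤ z i) : posWord (treeList z) = treeWord z := by
  unfold posWord treeList treeWord
  rw [List.map_flatMap]
  refine flatMap_congr_of fun κ _ => ?_
  obtain ⟨m, hm⟩ := Int.eq_ofNat_of_zero_le (hz κ)
  rw [hm, Int.toNat_natCast, seg_natCast, List.map_replicate]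

omit [Fintype Y] [DecidableEq Y] in
/-- The displacement of a positive word counts its letters: `disp (posWord u) κ = #{κ in u}`. [folklore] -/
theorem disp_posWord_apply : ∀ (u : List (Fin ν)) (κ : Fin ν), disp (posWord u) κ = (u.count κ : ℤ)
  | [], κ => by simp
  | a :: u, κ => by
    rw [posWord_cons, disp_cons, Pi.add_apply, Letter.vec_true, e_apply, disp_posWord_apply u κ, List.count_cons]
    by_cases h : a = κ
    · subst h; simp [add_comm]
    · simp [h, Ne.symm h]

omit [Fintype Y] [DecidableEq Y] in
/-- Positive words with the same displacement are permutations of each other. [folklore] -/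
theorem perm_of_disp_eq {u₁ u₂ : List (Fin ν)} (h : disp (posWord u₁) = disp (posWord u₂)) : u₁.Perm u₂ := by
  rw [List.perm_iff_count]
  intro κ
  have := congrFun h κ
  rw [disp_posWord_apply, disp_posWord_apply] at this
  exact_mod_cast this

omit [Fintype Y] [DecidableEq Y] in
/-- `disp (posWord (treeList z)) = z` for `z ≥ 0`. [folklore] -/
theorem disp_posWord_treeList (z : Site ν) (hz : ∀ i, 0 ≤ z i) : disp (posWord (treeList z)) = z := by
  rw [posWord_treeList z hz, disp_treeWord]

omit [Fintype Y] [DecidableEq Y] in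
/-- `|treeList z| = |z|₁`. [folklore] -/
theorem length_treeList (z : Site ν) (hz : ∀ i, 0 ≤ z i) : (treeList z).length = l1 z := by
  rw [← length_posWord, posWord_treeList z hz, length_treeWord]

omit [Fintype Y] [DecidableEq Y] in
/-- `|emb v|₁ ≤ ν(n − 1)` (natural numbers). [folklore] -/
theorem l1_emb_le_nat (v : Off ν n) : l1 (emb v) ≤ ν * (n - 1) := by
  unfold l1
  calc ∑ i, (emb v i).natAbs ≤ ∑ _i : Fin ν, (n - 1) := Finset.sum_le_sum fun i _ => by
          have := (v i).isLt
          simp only [emb, Int.natAbs_natCast]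
          omega
    _ = ν * (n - 1) := by rw [Finset.sum_const, Finset.card_univ, Fintype.card_fin, smul_eq_mul]

/-! ## §2 The ω-transports: the block average through ANY monotone contour family -/

variable [NeZero n] (W : Bond Y ν n → Matrix Cp Cp ℝ) (hW : ∀ b, (W b)ᵀ * W b = 1)
variable (ω : Off ν n → List (Fin ν))

/-- **THE ω-TRANSPORT** of a site to its block corner along the monotone contour `posWord (ω v)` — MODEL of the contour
variable `R(U(Γ^{(j)}_{y,x}))` of (3.19) with `Γ^{(j)}` ANY monotone contour family (the recursive chains (3.55) included).
[cite: Balaban1985BackgroundPropagators, (3.19) p.393, (3.55) p.401] -/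
def Rgen (x : BSite Y ν n) : Matrix Cp Cp ℝ :=
  ((hol (rawCfg W hW x.1) 0 (posWord (ω x.2)) : (Matrix Cp Cp ℝ)ˣ) : Matrix Cp Cp ℝ)

/-- As a transport family for `covFamily`. [folklore] -/
def RgenFam : Y → BSite Y ν n → Matrix Cp Cp ℝ := fun _ x => Rgen W hW ω x

/-! ## §3 The mixed loop «tree contour vs ω-contour» and its defect -/

omit [Fintype Y] [DecidableEq Y] in
/-- The mixed loop is the monotone loop `W(treeWord)·W(posWord ω)⁻¹`, read in `Matrix Cp Cp ℂ`. [folklore] -/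
theorem cpxHom_mixed_eq (x : BSite Y ν n) :
    cpxHom (Rtr W hW x * (Rgen W hW ω x)ᵀ) =
      ((hol (cpxCfg W hW x.1) 0 (posWord (treeList (emb x.2))) *
          (hol (cpxCfg W hW x.1) 0 (posWord (ω x.2)))⁻¹ : (Matrix Cp Cp ℂ)ˣ) : Matrix Cp Cp ℂ) := by
  have hz : ∀ i, 0 ≤ emb x.2 i := fun i => (emb_inBox x.2 i).1
  have hφ : ∀ w : List (Letter ν), hol (cpxCfg W hW x.1) 0 w =
      Units.map (cpxHom (Cp := Cp) : Matrix Cp Cp ℝ →* Matrix Cp Cp ℂ) (hol (rawCfg W hW x.1) 0 w) :=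
    fun w => hol_map _ (rawCfg W hW x.1) 0 w
  rw [hφ, hφ, ← map_inv, ← map_mul, Units.coe_map, Units.val_mul, val_inv_eq_transpose (hol_rawCfg_mem W hW _ _ _),
    posWord_treeList _ hz, MonoidHom.coe_coe]
  rfl

omit [Fintype Y] [DecidableEq Y] in
/-- **THE MIXED-LOOP DEFECT**: for ANY contour family `ω` with `disp (posWord (ω v)) = emb v`, if every in-block plaquette
of `W` is within `α` of `1` then `‖cpx(Rtr x·(Rgen ω x)ᵀ) − 1‖ ≤ (ν(n−1) choose 2)·α` — the area law for monotone loops.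
[cite: Balaban1985BackgroundPropagators, (3.55) p.401, (3.35) p.396] -/
theorem norm_mixed_loop_le [Nonempty Cp] (hω : ∀ v, disp (posWord (ω v)) = emb v) {α : ℝ} (hα : 0 ≤ α)
    (hplaqW : ∀ (y : Y) (v : Off ν n) (κ μ : Fin ν) (hκ : (v κ : ℕ) + 1 < n) (hμ : (v μ : ℕ) + 1 < n), κ ≠ μ →
      ‖cpxHom (plaqW W y v κ μ hκ hμ) - 1‖ ≤ α) (x : BSite Y ν n) :
    ‖cpxHom (Rtr W hW x * (Rgen W hW ω x)ᵀ) - 1‖ ≤ ((ν * (n - 1)).choose 2 : ℕ) * α := by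
  have hn1 : ∀ i, (0 : Site ν) i ≤ boxHi ν n i := fun i => by
    have := Nat.pos_of_ne_zero (NeZero.ne n)
    simp only [boxHi, Pi.zero_apply]; omega
  have hz : ∀ i, 0 ≤ emb x.2 i := fun i => (emb_inBox x.2 i).1
  have hperm : (treeList (emb x.2)).Perm (ω x.2) :=
    perm_of_disp_eq (by rw [disp_posWord_treeList _ hz, hω])
  have hP := norm_hol_posWord_perm_le_of_plaquettes hn1 (cpxCfg W hW x.1) (cpxCfg_mem W hW x.1) hα
    (fun z κ μ hκμ hz' => by
      obtain ⟨v, rfl, hκ, hμ⟩ := exists_off_of_plaqIn hz'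
      rw [val_hol_cpxCfg, hol_rawCfg_plaqWord W hW x.1 v hκ hμ]
      exact hplaqW x.1 v κ μ hκ hμ hκμ)
    (x := 0) (fun i => ⟨le_rfl, hn1 i⟩) hperm (by rw [disp_posWord_treeList _ hz, zero_add]; exact emb_inBox _)
  rw [cpxHom_mixed_eq]
  refine hP.trans (mul_le_mul_of_nonneg_right ?_ hα)
  rw [length_treeList _ hz]
  exact_mod_cast Nat.choose_le_choose 2 (l1_emb_le_nat x.2)

omit [Fintype Y] [DecidableEq Y] in
/-- … in d4-p3's `hdef` currency: `‖(cpx(Rtr·Rgenᵀ) − 1)·v‖ ≤ ε·‖v‖` for every block, site and fibre vector. [folklore] -/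
theorem mixed_defect_le [Nonempty Cp] (hω : ∀ v, disp (posWord (ω v)) = emb v) {α : ℝ} (hα : 0 ≤ α)
    (hplaqW : ∀ (y : Y) (v : Off ν n) (κ μ : Fin ν) (hκ : (v κ : ℕ) + 1 < n) (hμ : (v μ : ℕ) + 1 < n), κ ≠ μ →
      ‖cpxHom (plaqW W y v κ μ hκ hμ) - 1‖ ≤ α) (y : Y) (x : BSite Y ν n) (v : Cp → ℂ) :
    CoarseCoerciveCovariantEnergy.l2
        ((CoarseCoerciveCovariantEnergy.cpx (Rfam W hW y x * (RgenFam W hW ω y x)ᵀ) - 1) *ᵥ v) ≤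
      ((ν * (n - 1)).choose 2 : ℕ) * α * CoarseCoerciveCovariantEnergy.l2 v := by
  have hc : CoarseCoerciveCovariantEnergy.cpx (Rfam W hW y x * (RgenFam W hW ω y x)ᵀ) - 1 =
      cpxHom (Rtr W hW x * (Rgen W hW ω x)ᵀ) - 1 := by
    rw [CoarseCoerciveCovariantEnergy.cpx]; rfl
  rw [hc]
  exact (norm_toLp_mulVec_le _ v).trans
    (mul_le_mul_of_nonneg_right (norm_mixed_loop_le W hW ω hω hα hplaqW x) (norm_nonneg _))

/-! ## §4 THE END with two transports -/

omit [Fintype Y] [NeZero n] in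
/-- `t·s ≥ 0` (plateaus and block-mean weights are nonnegative). [folklore] -/
theorem tB_mul_sB_nonneg (hw : 0 < w) (y : Y) (x : BSite Y ν n) : 0 ≤ tB w y x * sB y x := by
  unfold tB sB
  split_ifs
  · exact mul_nonneg (pP_nonneg hw _) (by positivity)
  · simp

/-- **E-I3 WITH TWO TRANSPORTS, MODEL INSTANCE.**  Blocks of side `n` in `ν` dimensions, ANY gluing `σ`, fibre `Cp`, ANY
orthogonal bond transporters `W` whose in-block plaquettes are within `α` of `1`; the covariant block average `Q̃_ω` on ANY
monotone contour family `ω` (recursive chains (3.55) included), the quasi-reconstruction on the tree transports; fine operator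
`A_W = μ₀·1 + D_Wᴴ D_W`.  With `H = ν(n−1)·α` (thin loops, part 1) and `ε = (ν(n−1) choose 2)·α < 1` (mixed loops):
`((1 − ε)·((n−2w)/n)^ν)² / (μ₀·n^ν + (1/w + H)(ν n^ν (1/w + H))) · ‖B‖² ≤ Re B*(Q̃_ω A_W⁻¹ Q̃_ωᵀ)B` — d4-p3's
`coarse_coercive_cov₂` BY NAME. [cite: Balaban1985BackgroundPropagators, (3.19) p.393, (3.55) p.401] -/
theorem coarse_coercive_plateau_blocks_pair [Nonempty Cp] (σ : Fin ν → Y → Y) (hω : ∀ v, disp (posWord (ω v)) = emb v)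
    (hw : 0 < w) (h2w : 2 * w < n) {μ0 : ℝ} (hμ0 : 0 < μ0) {α : ℝ} (hα : 0 ≤ α)
    (hε : ((ν * (n - 1)).choose 2 : ℕ) * α < 1)
    (hplaqW : ∀ (y : Y) (v : Off ν n) (κ μ : Fin ν) (hκ : (v κ : ℕ) + 1 < n) (hμ : (v μ : ℕ) + 1 < n), κ ≠ μ →
      ‖cpxHom (plaqW W y v κ μ hκ hμ) - 1‖ ≤ α) (B : Y × Cp → ℂ) :
    ((1 - ((ν * (n - 1)).choose 2 : ℕ) * α) * (((n : ℝ) - 2 * w) / n) ^ ν) ^ 2 /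
        (μ0 * (1 * (n : ℝ) ^ ν) + (1 / w + ν * ((n : ℝ) - 1) * α) * (ν * (n : ℝ) ^ ν * (1 / w + ν * ((n : ℝ) - 1) * α))) *
      nsq B ≤ (star B ⬝ᵥ (sandwich (gramForm μ0 (covDiff bsrc (btgt σ) W)) (covFamily sB (RgenFam W hW ω)) *ᵥ B)).re := by
  have hn : (0 : ℝ) < n := by exact_mod_cast Nat.pos_of_ne_zero (NeZero.ne n)
  have hH0 : 0 ≤ ν * ((n : ℝ) - 1) * α := by
    have : (1 : ℝ) ≤ n := by exact_mod_cast Nat.pos_of_ne_zero (NeZero.ne n)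
    have : 0 ≤ (n : ℝ) - 1 := by linarith
    positivity
  have hH := fun (b : Bond Y ν n) (hb : (b.1.2 b.2 : ℕ) + 1 < n) (y : Y) => hdef_le_of_plaqW W hW σ hα hplaqW hb y
  have hδ0 : 0 < (((n : ℝ) - 2 * w) / n) ^ ν := by
    have : (0 : ℝ) < (n : ℝ) - 2 * w := by
      have : (2 * w : ℝ) < n := by exact_mod_cast h2w
      linarith
    positivity
  have hθ0 : (0 : ℝ) ≤ 1 / w + ν * ((n : ℝ) - 1) * α := by positivity
  have hE : 0 < μ0 * (1 * (n : ℝ) ^ ν) +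
      (1 / w + ν * ((n : ℝ) - 1) * α) * (ν * (n : ℝ) ^ ν * (1 / w + ν * ((n : ℝ) - 1) * α)) := by positivity
  exact coarse_coercive_cov₂ (gramForm μ0 (covDiff bsrc (btgt σ) W)) (gramForm_isHermitian _ _) (isUnit_gramForm hμ0 _)
    (re_form_gramForm_nonneg hμ0.le _) bsrc (btgt σ) W hμ0.le (fun z => (re_form_gramForm μ0 _ z).le) (tB w) sB
    (fun y y' x h => tB_mul_sB_eq_zero y y' x h) (tB_mul_sB_nonneg hw) (RgenFam W hW ω) (Rfam W hW)
    (fun _ x => Rtr_mul_transpose W hW x) hW hδ0 (mass_ge hw h2w.le) hε (mixed_defect_le W hW ω hω hα hplaqW)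
    (hdef W hW σ) (hdef_nonneg W hW σ) (hhol_hdef W hW σ) zero_le_one (sum_abs_tB_site_le hw) (sum_abs_tB_block_le hw)
    hθ0 (row_le W hW σ hw hH0 hH) (col_le W hW σ hw hH0 hH) hE B

/-! ## §5 The (3.55)-shape instance: recursive chains through nested sub-block corners -/

omit [NeZero n] in
/-- The corner of the `L^l`-sub-block containing `v`: `L^l·⌊v_i ∕ L^l⌋` componentwise — the nested BASE POINTS `x_l` of (3.55)
(`x ∈ B^l(x_l)`; print's blocks are CORNER blocks, [B5] (1.6) «B(y) = {x ∈ T₁ : y_μ ≤ x_μ < y_μ + L}», in tree as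
`B5AveragingTorus`; v1.0.1 docstring precision after d4-p3-g7's XREAD INFO-1, journal l.16440 — was «MODEL of the block centres»).
[cite: Balaban1985BackgroundPropagators, (3.55) p.401] -/
def crn (L l : ℕ) (v : Off ν n) : Site ν := fun i => ((L ^ l * ((v i : ℕ) / L ^ l) : ℕ) : ℤ)

omit [NeZero n] in
/-- `crn L 0 v = emb v`. [folklore] -/
theorem crn_zero (L : ℕ) (v : Off ν n) : crn L 0 v = emb v := by
  funext i; simp [crn, emb]

omit [NeZero n] in
/-- The corners are nested: `crn L (l+1) v ≤ crn L l v` componentwise (a multiple of `L^{l+1}` below `v_i` is a multiple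
of `L^l` below `v_i`). [folklore] -/
theorem crn_succ_le (L l : ℕ) (v : Off ν n) (i : Fin ν) : crn L (l + 1) v i ≤ crn L l v i := by
  simp only [crn, Nat.cast_le]
  rcases Nat.eq_zero_or_pos (L ^ l) with h0 | hpos
  · simp [pow_succ, h0]
  · have h1 : L ^ (l + 1) * ((v i : ℕ) / L ^ (l + 1)) ≤ (v i : ℕ) := Nat.mul_div_le _ _
    have h2 : L ^ l ∣ L ^ (l + 1) * ((v i : ℕ) / L ^ (l + 1)) := Dvd.dvd.mul_right (pow_dvd_pow L (Nat.le_succ l)) _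
    obtain ⟨q, hq⟩ := h2
    rw [hq] at h1 ⊢
    exact Nat.mul_le_mul_left _ ((Nat.le_div_iff_mul_le hpos).mpr (by rw [mul_comm]; exact h1))

omit [NeZero n] in
/-- `0 ≤ crn`. [folklore] -/
theorem crn_nonneg (L l : ℕ) (v : Off ν n) (i : Fin ν) : 0 ≤ crn L l v i := by
  unfold crn
  exact Int.natCast_nonneg _

omit [NeZero n] in
/-- The stairs of the recursive chain below level `m`: `crn L m v → crn L (m−1) v → ⋯ → crn L 0 v = emb v`, each leg the
tree contour of the (nonnegative) difference. [folklore] -/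
def stairs (L : ℕ) (v : Off ν n) : ℕ → List (Fin ν)
  | 0 => []
  | m + 1 => treeList (crn L m v - crn L (m + 1) v) ++ stairs L v m

omit [NeZero n] in
/-- **THE RECURSIVE CONTOUR** (MODEL of (3.55)): from the block corner `0` to the corner of the `L^m`-sub-block of `v`, then
down the nested corners to `v`. [cite: Balaban1985BackgroundPropagators, (3.55) p.401] -/
def nestedList (L m : ℕ) (v : Off ν n) : List (Fin ν) := treeList (crn L m v) ++ stairs L v m

omit [NeZero n] in
/-- The stairs displace by `emb v − crn L m v`. [folklore] -/
theorem disp_posWord_stairs (L : ℕ) (v : Off ν n) : ∀ m : ℕ, disp (posWord (stairs L v m)) = emb v - crn L m v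
  | 0 => by simp [stairs, crn_zero]
  | m + 1 => by
    rw [stairs, posWord_append, disp_append, disp_posWord_stairs L v m,
      disp_posWord_treeList (crn L m v - crn L (m + 1) v)
        (fun i => by rw [Pi.sub_apply]; exact sub_nonneg.mpr (crn_succ_le L m v i))]
    abel

omit [NeZero n] in
/-- **The recursive contour ends at `v`**: `disp (posWord (nestedList L m v)) = emb v` — so it is an admissible `ω` of §4.
[folklore] -/
theorem disp_posWord_nestedList (L m : ℕ) (v : Off ν n) : disp (posWord (nestedList L m v)) = emb v := by
  rw [nestedList, posWord_append, disp_append, disp_posWord_stairs, disp_posWord_treeList (crn L m v) (crn_nonneg L m v)]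
  abel

/-- **E-I3 WITH THE RECURSIVE CONTOURS OF (3.55) (MODEL)**: the two-transport END of §4 for the block average running
through the nested-corner chains `nestedList L m` (any `L`, any depth `m`), bumps on the tree transports, every orthogonal
`W` with in-block plaquettes within `α` of `1`. [cite: Balaban1985BackgroundPropagators, (3.19) p.393, (3.55) p.401] -/
theorem coarse_coercive_plateau_blocks_nested [Nonempty Cp] (σ : Fin ν → Y → Y) (L m : ℕ) (hw : 0 < w) (h2w : 2 * w < n)
    {μ0 : ℝ} (hμ0 : 0 < μ0) {α : ℝ} (hα : 0 ≤ α) (hε : ((ν * (n - 1)).choose 2 : ℕ) * α < 1)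
    (hplaqW : ∀ (y : Y) (v : Off ν n) (κ μ : Fin ν) (hκ : (v κ : ℕ) + 1 < n) (hμ : (v μ : ℕ) + 1 < n), κ ≠ μ →
      ‖cpxHom (plaqW W y v κ μ hκ hμ) - 1‖ ≤ α) (B : Y × Cp → ℂ) :
    ((1 - ((ν * (n - 1)).choose 2 : ℕ) * α) * (((n : ℝ) - 2 * w) / n) ^ ν) ^ 2 /
        (μ0 * (1 * (n : ℝ) ^ ν) + (1 / w + ν * ((n : ℝ) - 1) * α) * (ν * (n : ℝ) ^ ν * (1 / w + ν * ((n : ℝ) - 1) * α))) *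
      nsq B ≤ (star B ⬝ᵥ (sandwich (gramForm μ0 (covDiff bsrc (btgt σ) W))
        (covFamily sB (RgenFam W hW (nestedList L m))) *ᵥ B)).re :=
  coarse_coercive_plateau_blocks_pair W hW (nestedList L m) σ (disp_posWord_nestedList L m) hw h2w hμ0 hα hε hplaqW B

/-! ## §6 Non-vacuity -/

/-- One block of side 3 (`ν = 1`, `w = 1`, fibre `Unit`, flat `W ≡ 1`, `μ₀ = 1`, `α = 0`), the recursive contour with
`L = 2`, depth `1`: the two-transport END holds with the explicit constant `1/54`. [folklore] -/
example (B : Unit × Unit → ℂ) :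
    (1 / 54 : ℝ) * nsq B ≤
      (star B ⬝ᵥ (sandwich (gramForm 1 (covDiff bsrc (btgt (fun (_ : Fin 1) (_ : Unit) => ()))
          fun _ : Bond Unit 1 3 => (1 : Matrix Unit Unit ℝ)))
        (covFamily (sB (Y := Unit) (ν := 1) (n := 3))
          (RgenFam (fun _ : Bond Unit 1 3 => (1 : Matrix Unit Unit ℝ)) flat_orth (nestedList 2 1))) *ᵥ B)).re := by
  have h := coarse_coercive_plateau_blocks_nested (Y := Unit) (Cp := Unit) (ν := 1) (n := 3) (w := 1) (μ0 := 1) (α := 0)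
    (fun _ : Bond Unit 1 3 => (1 : Matrix Unit Unit ℝ)) flat_orth (fun (_ : Fin 1) (_ : Unit) => ()) 2 1 Nat.one_pos
    (by norm_num) one_pos le_rfl (by norm_num) (fun y v κ μ hκ hμ _ => by simp [plaqW]) B
  convert h using 2
  norm_num

end

end Summit.QuantumFields.BalabanUV.Beta.CovariantPlateauBlocksPair
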